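import Literature.Analysis.UnboundedOperators.UnitaryGroupSmearing
import Literature.Analysis.UnboundedOperators.UnitaryGroupGenerator
import Mathlib.Analysis.Distribution.SchwartzSpace.Fourier
import Mathlib.Analysis.InnerProductSpace.Positive
import Mathlib.Analysis.Normed.Operator.Compact.Basic
import Mathlib.MeasureTheory.Integral.ExpDecay
import HarnessLib

/-!
# Regularity classes `C¹(A)`, `𝒞^{1,1}(A)` and the Mourre estimate relative to a conjugate operator

Topic `Literature/Analysis/UnboundedOperators` (next to `UnitaryRep`, `UnitaryGroupSmearing`); the
abstract half of the definition request `defn-SecondQuantisedConjugateOperator` (route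
`EmbeddedDrudeMourre` of `AtomisticToContinuum/FouriersLaw`, layer-2 item `OddMourreEstimate`:
"the class `C¹(𝒜)` / `C^{1,1}(𝒜)` regularity predicates of Amrein–Boutet de Monvel–Georgescu for a
self-adjoint operator `H` relative to `𝒜`" and "the Mourre inequality in FORM sense on vectors
`f(H)ψ`, `f ∈ C_c^∞`, realised through the unitary group"); also wanted by the hard-sphere route
`MourreKoopmanCharges` (`TwoScaleMourreAtZero`, `CollisionCommutatorRegularity`).

Everything is phrased through TWO strongly continuous one-parameter unitary groups on a complex
Hilbert space `H` (the tree's `OneParameterUnitaryGroup`, `U.appReal t`):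
the CONJUGATE OPERATOR `A` enters only through `W(x) = A.appReal x = e^{iAx}`, and the HAMILTONIAN
only through `U(t) = U.appReal t = e^{itH}`; no unbounded operator, spectral projection or spectral
theorem is used, so every definition below has an honest body over Mathlib.

## Contents (ABG = Amrein–Boutet de Monvel–Georgescu 1996)

* §1 `conjAut A x S = W(-x) S W(x)` — the automorphism group `𝒲(x)[S]` of `B(H)` (ABG (5.0.1)),
  with the group law, isometry `‖𝒲(x)S‖ = ‖S‖`, multiplicativity and `*`-compatibility PROVED.
* §2 `HasCommutator A S D` (`x ↦ 𝒲(x)S` has strong derivative `D` at `0`), the class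
  `IsOfClassC1 A S` (`= C¹(A; H)`, ABG Def. 5.1.1 with Prop. 5.1.2 (a): a derivative at one point
  suffices) and the bounded commutator `commutatorCLM A S = [S, iA] = d/dx 𝒲(x)S |₀` (ABG (5.1.1),
  (5.1.4)); PROVED: uniqueness, linearity, the derivative at every point
  (`HasCommutator.hasDerivAt_conjAut`, ABG (5.1.12)), the Leibniz rule
  `[ST, iA] = [S, iA]T + S[T, iA]` (`HasCommutator.mul`, ABG Prop. 5.1.5: `C¹(A)` is an algebra),
  and the identification `[S, iA]f = S(iAf) - iA(Sf)` on `D(A)` (`HasCommutator.apply_eq`).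
* §3 `secondDifference A x S = [𝒲(x) - 1]² S` and the Besov class `IsOfClassC11 A S`
  (`= 𝒞^{1,1}(A; H)`: `∫_{|x| ≤ 1} ‖[𝒲(x) - 1]² S‖ dx / x² < ∞`, ABG (5.2.1) with `s = 1`, `p = 1`,
  `ℓ = 2`), written as a lower Lebesgue integral (no measurability side condition; ABG p. 5.2 note
  that the integrand is lower semicontinuous).
* §4 The bounded operators through which an unbounded `H` is handled: `smear U k = ∫ k(a) U(a) da`
  (the tree's smearing, bundled), `resolventNegI U = (H + i)⁻¹ = -i ∫₀^∞ e^{-t} U(t) dt` (PROVED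
  to invert `H + i` on `D(H)`: `resolventNegI_hamiltonian_add`, by integration by parts), and ABG's
  Def. 6.2.2 `HamiltonianOfClassC1 U A` / `HamiltonianOfClassC11 U A` (`H` is of class `C¹(A)`,
  resp. `𝒞^{1,1}(A)`, iff its resolvent is; one point of the resolvent set suffices by ABG
  Lemma 6.2.1, we take `z = -i`).
* §5 The smooth functional calculus through the group, `fourierCalculus U g = ∫ 𝓕g(a) U(a) da
  = g(H/2π)` (the `2π` dictionary of `FourierSpectrum.lean`), `energyMul g = (ξ ↦ 2πξ g(ξ))`
  (so that `energyMul g (H/2π) = H g(H/2π)`), the LOCALISED FIRST COMMUTATOR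
  `mourreCommutator U A g = φ(H)[H, iA]φ(H) := φ(H)[φ₁(H), iA] - φ₁(H)[φ(H), iA]`
  (`φ = g(·/2π)`, `φ₁(x) = xφ(x)`; ABG (7.2.18)), and the MOURRE ESTIMATE in the smooth form
  ABG (7.2.7)/(7.2.16): `HasMourreEstimateOn U A J a` (strict: `a φ(H)² ≤ φ(H)[H,iA]φ(H)` for all
  real `φ ∈ C_c^∞(J)`), `HasMourreEstimateWithCompactOn` (with a compact remainder `K`),
  `IsStrictlyConjugateAt` / `IsConjugateAt` (ABG §7.2.2 terminology: `ϱ_H^A(λ) > 0`, resp.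
  `ϱ̃_H^A(λ) > 0`), with monotonicity lemmas.

## What is NOT here (and why)

* No theorem of Mourre theory (virial theorem, LAP, absence of singular continuous spectrum —
  Mourre 1981, ABG Thm. 7.4.1): those are facts to be vendored/proved separately on top of these
  predicates. Likewise ABG Thm. 6.2.5 (`H ∈ C¹(A) ⇒ φ(H) ∈ C¹(A; H)`) is not proved; therefore
  `HasMourreEstimateOn` ASKS for `φ(H), φ₁(H) ∈ C¹(A; H)` (local regularity in the sense of Sahbani)
  before stating the inequality, which under ABG's standing hypothesis `H ∈ C¹(A)` (§7.2) is automatic.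
* The inclusions `𝒞^{1,1} ⊂ C¹_u ⊂ C¹` (ABG (5.2.19)) are not proved: `HamiltonianOfClassC11` is
  literally the Besov condition on the resolvent; users needing both assume both.
* Real Hilbert spaces: a conjugate operator at frequency `0` for a REAL orthogonal Koopman group
  cannot itself generate a real orthogonal group (its first commutator would be skew); the theory is
  complex, and real fluctuation spaces (`FluctuationSpace.lean`) must be complexified downstream.
* `ϱ_H^A(λ)` as an extended-real function is not introduced (only the predicates with an explicit
  constant `a`), to avoid `sSup` junk on empty/unbounded sets.

## References

* W. O. Amrein, A. Boutet de Monvel, V. Georgescu, *C₀-Groups, Commutator Methods and Spectral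
  Theory of N-Body Hamiltonians*, Birkhäuser 1996: (5.0.1), Def. 5.1.1, Prop. 5.1.2, Prop. 5.1.5,
  (5.2.1), (5.2.19), Thm. 5.2.6, Lemma 6.2.1, Def. 6.2.2, (7.2.4)–(7.2.7), (7.2.16), (7.2.18).
  [AmreinBoutetdeMonvelGeorgescu1996]
* E. Mourre, *Absence of singular continuous spectrum for certain self-adjoint operators*,
  Comm. Math. Phys. 78 (1981) 391–408, conditions (a)–(e) and the estimate
  `E_Δ i[H, A] E_Δ ≥ α E_Δ + K`. [Mourre1981]
-/

noncomputable section

open Filter Set Asymptotics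
open _root_.MeasureTheory _root_.Complex
open scoped InnerProductSpace ComplexConjugate SchwartzMap FourierTransform ENNReal
open scoped _root_.Topology

namespace Literature.Analysis.UnboundedOperators

namespace UnitaryRep

variable {H : Type*} [NormedAddCommGroup H] [InnerProductSpace ℂ H] [CompleteSpace H]

/-! ## §1. The automorphism group `𝒲(x)[S] = e^{-iAx} S e^{iAx}` of `B(H)` -/

section ConjAut

variable (A : OneParameterUnitaryGroup H)

/-- `‖W(x)‖ ≤ 1` for a one-parameter unitary group. [folklore] -/
theorem norm_appReal_le_one (x : ℝ) : ‖A.appReal x‖ ≤ 1 :=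
  ContinuousLinearMap.opNorm_le_bound _ zero_le_one fun f => by rw [one_mul, norm_appReal]

/-- `W(x)* = W(-x)`. [folklore] -/
theorem star_appReal (x : ℝ) : star (A.appReal x) = A.appReal (-x) := by
  rw [ContinuousLinearMap.star_eq_adjoint, appReal, adjoint_apply]
  rfl

/-- **The automorphism group of a conjugate operator on bounded operators**:
`𝒲(x)[S] = S(x) := W(-x) S W(x) = e^{-iAx} S e^{iAx}` for `W(x) = e^{iAx}` the unitary group of the
(self-adjoint, in general unbounded) conjugate operator `A` and `S ∈ B(H)`.
[cite: AmreinBoutetdeMonvelGeorgescu1996, §5.0 eq. (5.0.1)] -/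
def conjAut (x : ℝ) (S : H →L[ℂ] H) : H →L[ℂ] H :=
  A.appReal (-x) * S * A.appReal x

/-- `𝒲(x)[S] f = W(-x) S W(x) f`. [folklore] -/
theorem conjAut_apply (x : ℝ) (S : H →L[ℂ] H) (f : H) :
    A.conjAut x S f = A.appReal (-x) (S (A.appReal x f)) := rfl

/-- `𝒲(0) = id`. [folklore] -/
@[simp] theorem conjAut_zero (S : H →L[ℂ] H) : A.conjAut 0 S = S := by
  simp [conjAut]

/-- The group law `𝒲(x + y) = 𝒲(x) 𝒲(y)`. [cite: AmreinBoutetdeMonvelGeorgescu1996, §5.0 after (5.0.2)] -/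
theorem conjAut_add (x y : ℝ) (S : H →L[ℂ] H) :
    A.conjAut (x + y) S = A.conjAut x (A.conjAut y S) := by
  rw [conjAut, neg_add, appReal_add, add_comm x y, appReal_add]
  simp only [conjAut, mul_assoc]

/-- `𝒲(x)[1] = 1`. [folklore] -/
@[simp] theorem conjAut_one (x : ℝ) : A.conjAut x 1 = 1 := by
  rw [conjAut, mul_one, ← appReal_add, neg_add_cancel, appReal_zero]

/-- `𝒲(x)[0] = 0`. [folklore] -/
@[simp] theorem conjAut_zero_op (x : ℝ) : A.conjAut x 0 = 0 := by
  simp [conjAut]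

/-- `𝒲(x)` is additive in the operator. [folklore] -/
theorem conjAut_add_op (x : ℝ) (S T : H →L[ℂ] H) :
    A.conjAut x (S + T) = A.conjAut x S + A.conjAut x T := by
  simp [conjAut, mul_add, add_mul]

/-- `𝒲(x)` is subtractive in the operator. [folklore] -/
theorem conjAut_sub_op (x : ℝ) (S T : H →L[ℂ] H) :
    A.conjAut x (S - T) = A.conjAut x S - A.conjAut x T := by
  simp [conjAut, mul_sub, sub_mul]

/-- `𝒲(x)` is homogeneous in the operator. [folklore] -/
theorem conjAut_smul_op (x : ℝ) (c : ℂ) (S : H →L[ℂ] H) :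
    A.conjAut x (c • S) = c • A.conjAut x S := by
  simp [conjAut]

/-- `𝒲(x)` is multiplicative: `𝒲(x)[ST] = 𝒲(x)[S] 𝒲(x)[T]` (an automorphism of `B(H)`).
[cite: AmreinBoutetdeMonvelGeorgescu1996, §5.1 (Banach algebras with automorphism groups)] -/
theorem conjAut_mul (x : ℝ) (S T : H →L[ℂ] H) :
    A.conjAut x (S * T) = A.conjAut x S * A.conjAut x T := by
  simp only [conjAut, mul_assoc]
  rw [← mul_assoc (A.appReal x) (A.appReal (-x)), ← appReal_add, add_neg_cancel, appReal_zero,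
    one_mul]

/-- `𝒲(x)` commutes with adjoints: `(𝒲(x)[S])* = 𝒲(x)[S*]` (`W` is unitary).
[cite: AmreinBoutetdeMonvelGeorgescu1996, Prop. 5.1.7] -/
theorem star_conjAut (x : ℝ) (S : H →L[ℂ] H) : star (A.conjAut x S) = A.conjAut x (star S) := by
  simp only [conjAut, star_mul, star_appReal, neg_neg, mul_assoc]

/-- `‖𝒲(x)[S]‖ ≤ ‖S‖`. [folklore] -/
theorem norm_conjAut_le (x : ℝ) (S : H →L[ℂ] H) : ‖A.conjAut x S‖ ≤ ‖S‖ := by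
  calc ‖A.conjAut x S‖ ≤ ‖A.appReal (-x) * S‖ * ‖A.appReal x‖ := norm_mul_le _ _
    _ ≤ ‖A.appReal (-x)‖ * ‖S‖ * ‖A.appReal x‖ := by
        gcongr
        exact norm_mul_le _ _
    _ ≤ 1 * ‖S‖ * 1 := by
        gcongr
        · exact A.norm_appReal_le_one _
        · exact A.norm_appReal_le_one _
    _ = ‖S‖ := by ring

/-- **`𝒲(x)` is isometric on `B(H)`** (unitary case of ABG (5.0.2), `M = 1`, `ω = 0`).
[cite: AmreinBoutetdeMonvelGeorgescu1996, §5.0 eq. (5.0.2)] -/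
theorem norm_conjAut (x : ℝ) (S : H →L[ℂ] H) : ‖A.conjAut x S‖ = ‖S‖ := by
  refine le_antisymm (A.norm_conjAut_le x S) ?_
  have h := A.norm_conjAut_le (-x) (A.conjAut x S)
  rwa [← conjAut_add, neg_add_cancel, conjAut_zero] at h

/-- Strong continuity of `x ↦ 𝒲(x)[S]` at `0`. [cite: AmreinBoutetdeMonvelGeorgescu1996, §5.0 after (5.0.2)] -/
theorem tendsto_conjAut_apply (S : H →L[ℂ] H) (f : H) :
    Tendsto (fun x : ℝ => A.conjAut x S f) (𝓝 0) (𝓝 (S f)) := by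
  have h : Tendsto (fun x : ℝ => S (A.appReal x f)) (𝓝 0) (𝓝 (S f)) := by
    have hc : Continuous fun x : ℝ => S (A.appReal x f) :=
      S.continuous.comp (A.continuous_appReal_apply f)
    simpa using hc.tendsto 0
  exact A.tendsto_appReal_neg_apply le_rfl h

end ConjAut

/-! ## §2. The class `C¹(A; H)` and the bounded commutator `[S, iA]` -/

section C1

variable (A : OneParameterUnitaryGroup H)

/-- `HasCommutator A S D`: the map `x ↦ 𝒲(x)[S] = e^{-iAx} S e^{iAx}` is strongly differentiable at
`x = 0` with derivative the bounded operator `D`; then `D = i(SA - AS) = [S, iA]` (ABG (5.1.1),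
(5.1.4): `∂ₓ 𝒲(x)[S] = i𝒜 𝒲(x)[S]`, `𝒜[S] = SA - AS`; see `HasCommutator.apply_eq`).
[cite: AmreinBoutetdeMonvelGeorgescu1996, §5.1 eqs. (5.1.1), (5.1.4)] -/
def HasCommutator (S D : H →L[ℂ] H) : Prop :=
  ∀ f : H, HasDerivAt (fun x : ℝ => A.conjAut x S f) (D f) 0

/-- **The regularity class `C¹(A; H)`** of bounded operators: `S ∈ C¹(A; H)` iff `x ↦ 𝒲(x)[S]` is
strongly of class `C¹` (ABG Def. 5.1.1 (a) with `k = 1`, `F' = F'' = H`), equivalently — by the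
group law and ABG Prop. 5.1.2 (a), a (weak) derivative at one point suffices — iff it has a strong
derivative at `0` given by a bounded operator, which is the form recorded here.
[cite: AmreinBoutetdeMonvelGeorgescu1996, Def. 5.1.1 and Prop. 5.1.2 (a)] -/
def IsOfClassC1 (S : H →L[ℂ] H) : Prop :=
  ∃ D : H →L[ℂ] H, A.HasCommutator S D

/-- **The commutator `[S, iA] ∈ B(H)`** of an operator of class `C¹(A; H)`: the strong derivative of
`x ↦ e^{-iAx} S e^{iAx}` at `0` (ABG (5.1.7) with `|α| = 1`; the operator `-i ad_A(S)` of (5.1.10)).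
Junk value `0` when `S ∉ C¹(A; H)` (documented; `commutatorCLM_of_not`).
[cite: AmreinBoutetdeMonvelGeorgescu1996, §5.1 eqs. (5.1.7), (5.1.10)] -/
def commutatorCLM (S : H →L[ℂ] H) : H →L[ℂ] H := by
  classical
  exact if h : A.IsOfClassC1 S then h.choose else 0

variable {A}

/-- The strong derivative is unique. [folklore] -/
theorem HasCommutator.unique {S D D' : H →L[ℂ] H} (h : A.HasCommutator S D)
    (h' : A.HasCommutator S D') : D = D' :=
  ContinuousLinearMap.ext fun f => (h f).unique (h' f)

/-- An operator with a bounded commutator is of class `C¹(A; H)`. [folklore] -/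
theorem HasCommutator.isOfClassC1 {S D : H →L[ℂ] H} (h : A.HasCommutator S D) : A.IsOfClassC1 S :=
  ⟨D, h⟩

/-- For `S ∈ C¹(A; H)`, `commutatorCLM A S` is the strong derivative of `𝒲(·)[S]` at `0`. [folklore] -/
theorem IsOfClassC1.hasCommutator {S : H →L[ℂ] H} (h : A.IsOfClassC1 S) :
    A.HasCommutator S (A.commutatorCLM S) := by
  rw [commutatorCLM, dif_pos h]
  exact h.choose_spec

/-- `commutatorCLM` computes any witnessed commutator. [folklore] -/
theorem HasCommutator.commutatorCLM_eq {S D : H →L[ℂ] H} (h : A.HasCommutator S D) :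
    A.commutatorCLM S = D :=
  h.isOfClassC1.hasCommutator.unique h

/-- Off `C¹(A; H)` the commutator is the junk value `0`. [folklore] -/
theorem commutatorCLM_of_not {S : H →L[ℂ] H} (h : ¬A.IsOfClassC1 S) : A.commutatorCLM S = 0 := by
  rw [commutatorCLM, dif_neg h]

variable (A)

/-- An operator fixed by the automorphism group (i.e. commuting with `A`) has commutator `0`.
[folklore] -/
theorem hasCommutator_zero_of_forall_conjAut_eq {S : H →L[ℂ] H} (hS : ∀ x, A.conjAut x S = S) :
    A.HasCommutator S 0 := fun f => by
  simp only [hS, zero_apply]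
  exact hasDerivAt_const _ _

/-- `[1, iA] = 0`. [folklore] -/
theorem hasCommutator_one : A.HasCommutator 1 0 :=
  A.hasCommutator_zero_of_forall_conjAut_eq fun x => A.conjAut_one x

/-- `[0, iA] = 0`. [folklore] -/
theorem hasCommutator_zero : A.HasCommutator 0 0 :=
  A.hasCommutator_zero_of_forall_conjAut_eq fun x => A.conjAut_zero_op x

/-- `1 ∈ C¹(A; H)`. [folklore] -/
theorem isOfClassC1_one : A.IsOfClassC1 1 := (A.hasCommutator_one).isOfClassC1

variable {A}

/-- Additivity: `[S + T, iA] = [S, iA] + [T, iA]` (`C¹(A; H)` is a vector space, ABG Def. 5.1.1).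
[cite: AmreinBoutetdeMonvelGeorgescu1996, Def. 5.1.1] -/
theorem HasCommutator.add {S T D E : H →L[ℂ] H} (hS : A.HasCommutator S D)
    (hT : A.HasCommutator T E) : A.HasCommutator (S + T) (D + E) := fun f => by
  simpa [conjAut_add_op] using (hS f).fun_add (hT f)

/-- Homogeneity: `[c • S, iA] = c • [S, iA]`. [cite: AmreinBoutetdeMonvelGeorgescu1996, Def. 5.1.1] -/
theorem HasCommutator.smul {S D : H →L[ℂ] H} (hS : A.HasCommutator S D) (c : ℂ) :
    A.HasCommutator (c • S) (c • D) := fun f => by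
  simpa [conjAut_smul_op] using (hS f).fun_const_smul c

/-- `C¹(A; H)` is closed under sums. [cite: AmreinBoutetdeMonvelGeorgescu1996, Def. 5.1.1] -/
theorem IsOfClassC1.add {S T : H →L[ℂ] H} (hS : A.IsOfClassC1 S) (hT : A.IsOfClassC1 T) :
    A.IsOfClassC1 (S + T) := by
  obtain ⟨D, hD⟩ := hS
  obtain ⟨E, hE⟩ := hT
  exact (hD.add hE).isOfClassC1

/-- `C¹(A; H)` is closed under scalar multiples. [cite: AmreinBoutetdeMonvelGeorgescu1996, Def. 5.1.1] -/
theorem IsOfClassC1.smul {S : H →L[ℂ] H} (hS : A.IsOfClassC1 S) (c : ℂ) :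
    A.IsOfClassC1 (c • S) := by
  obtain ⟨D, hD⟩ := hS
  exact (hD.smul c).isOfClassC1

/-- **The derivative at every point** (ABG (5.1.12) with `k = 1`): if `𝒲(·)[S]` has strong
derivative `D` at `0`, then it has strong derivative `𝒲(x)[D]` at `x`, by the group law.
[cite: AmreinBoutetdeMonvelGeorgescu1996, Prop. 5.1.2 (a) eq. (5.1.12)] -/
theorem HasCommutator.hasDerivAt_conjAut {S D : H →L[ℂ] H} (h : A.HasCommutator S D) (x : ℝ)
    (f : H) : HasDerivAt (fun y : ℝ => A.conjAut y S f) (A.conjAut x D f) x := by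
  have h1 : HasDerivAt (fun y : ℝ => A.conjAut (y - x) S (A.appReal x f)) (D (A.appReal x f)) x := by
    have h0 := h (A.appReal x f)
    rw [← sub_self x] at h0
    exact h0.comp_sub_const x x
  have h2 := ((A.appReal (-x)).restrictScalars ℝ).hasFDerivAt.comp_hasDerivAt x h1
  refine h2.congr_of_eventuallyEq (Eventually.of_forall fun y => ?_)
  simp only [Function.comp_apply, ContinuousLinearMap.coe_restrictScalars']
  rw [← conjAut_apply, ← conjAut_add, add_sub_cancel]

omit [CompleteSpace H] in
/-- A strong product rule at `0` for a uniformly bounded, strongly continuous family of bounded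
operators `F(x)` applied to a differentiable vector `u(x)`:
`d/dx F(x)u(x)|₀ = F'(0)u(0) + F(0)u'(0)`, needing the strong derivative of `F` only at the vector
`u(0)`. (The elementary lemma behind ABG Prop. 5.1.5.) [folklore] -/
theorem hasDerivAt_apply_of_strongDeriv {F : ℝ → H →L[ℂ] H} {u : ℝ → H} {u₀ u' v : H} {C : ℝ}
    (hFu : HasDerivAt (fun x => F x u₀) v 0)
    (hcont : Tendsto (fun x => F x u') (𝓝 0) (𝓝 (F 0 u')))
    (hC : ∀ x, ‖F x‖ ≤ C) (hu : HasDerivAt u u' 0) (hu0 : u 0 = u₀) :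
    HasDerivAt (fun x => F x (u x)) (v + F 0 u') 0 := by
  have h2 : HasDerivAt (fun x => F x (u x - u₀)) (F 0 u') 0 := by
    rw [hasDerivAt_iff_isLittleO_nhds_zero]
    simp only [zero_add, hu0, sub_self, map_zero]
    have hu' : (fun h : ℝ => u h - u₀ - h • u') =o[𝓝 0] fun h => h := by
      have := (hasDerivAt_iff_isLittleO_nhds_zero.1 hu)
      simpa [hu0] using this
    have h3 : (fun h : ℝ => F h (u h - u₀ - h • u')) =o[𝓝 0] fun h => h := by
      refine IsBigO.trans_isLittleO ?_ hu'
      refine IsBigO.of_bound C (Eventually.of_forall fun h => ?_)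
      exact (F h).le_of_opNorm_le (hC h) _
    have h4 : (fun h : ℝ => h • (F h u' - F 0 u')) =o[𝓝 0] fun h => h := by
      have h5 : (fun h : ℝ => F h u' - F 0 u') =o[𝓝 0] fun _ => (1 : ℝ) := by
        rw [isLittleO_one_iff]
        simpa using hcont.sub_const (F 0 u')
      have h6 := (isBigO_refl (fun h : ℝ => h) (𝓝 0)).smul_isLittleO h5
      simpa using h6
    refine (h3.add h4).congr_left fun h => ?_
    simp only [map_sub, ContinuousLinearMap.map_smul_of_tower, smul_sub]
    abel
  have h1 := hFu.add h2
  refine h1.congr_of_eventuallyEq (Eventually.of_forall fun x => ?_)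
  simp [map_sub]

/-- **Leibniz rule** (ABG Prop. 5.1.5, `k = 1`: `C¹(A; H)` is a subalgebra of `B(H)` and
`𝒜[ST] = 𝒜[S]T + S𝒜[T]`): `[ST, iA] = [S, iA] T + S [T, iA]`.
[cite: AmreinBoutetdeMonvelGeorgescu1996, Prop. 5.1.5] -/
theorem HasCommutator.mul {S T D E : H →L[ℂ] H} (hS : A.HasCommutator S D)
    (hT : A.HasCommutator T E) : A.HasCommutator (S * T) (D * T + S * E) := fun f => by
  have key : HasDerivAt (fun x : ℝ => A.conjAut x S (A.conjAut x T f))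
      (D (T f) + A.conjAut 0 S (E f)) 0 :=
    hasDerivAt_apply_of_strongDeriv (F := fun x => A.conjAut x S) (u := fun x => A.conjAut x T f)
      (hS (T f)) (by simpa using A.tendsto_conjAut_apply S (E f))
      (fun x => A.norm_conjAut_le x S) (hT f) (by simp)
  simp only [conjAut_zero] at key
  refine key.congr_of_eventuallyEq (Eventually.of_forall fun x => ?_)
  simp only [conjAut_mul, mul_apply_eq_comp]

/-- `C¹(A; H)` is closed under products (ABG Prop. 5.1.5).
[cite: AmreinBoutetdeMonvelGeorgescu1996, Prop. 5.1.5] -/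
theorem IsOfClassC1.mul {S T : H →L[ℂ] H} (hS : A.IsOfClassC1 S) (hT : A.IsOfClassC1 T) :
    A.IsOfClassC1 (S * T) := by
  obtain ⟨D, hD⟩ := hS
  obtain ⟨E, hE⟩ := hT
  exact (hD.mul hE).isOfClassC1

/-- **`[S, iA]` is the commutator**: for `f ∈ D(A)` with `S f ∈ D(A)`,
`[S, iA] f = S (iA f) - iA (S f)`, where `iA = OneParameterGroup.generator` is the generator of
`W(x) = e^{iAx}` (`d/dx W(x) f = W(x) (iA f)`; ABG (5.1.4): `𝒜[S] = SA - AS`, times `i`).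
[cite: AmreinBoutetdeMonvelGeorgescu1996, §5.1 eq. (5.1.4)] -/
theorem HasCommutator.apply_eq {S D : H →L[ℂ] H} (h : A.HasCommutator S D) {f : H}
    (hf : f ∈ (OneParameterGroup.generator A.toStrongContRepresentation).domain)
    (hSf : S f ∈ (OneParameterGroup.generator A.toStrongContRepresentation).domain) :
    D f = S (OneParameterGroup.generator A.toStrongContRepresentation ⟨f, hf⟩) -
      OneParameterGroup.generator A.toStrongContRepresentation ⟨S f, hSf⟩ := by
  set gen := OneParameterGroup.generator A.toStrongContRepresentation with hgen
  -- `u x = S (W x f)`, `u' = S (iA f)`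
  have hu : HasDerivAt (fun x : ℝ => S (A.appReal x f)) (S (gen ⟨f, hf⟩)) 0 := by
    have h0 := A.hasDerivAt_appReal_apply ⟨f, hf⟩ 0
    simp only [appReal_zero, one_apply_eq_self] at h0
    exact (S.restrictScalars ℝ).hasFDerivAt.comp_hasDerivAt 0 h0
  -- `F x = W(-x)`, derivative at the vector `S f ∈ D(A)`
  have hFu : HasDerivAt (fun x : ℝ => A.appReal (-x) (S f)) (-(gen ⟨S f, hSf⟩)) 0 := by
    have h0 := A.hasDerivAt_appReal_apply ⟨S f, hSf⟩ 0
    simp only [appReal_zero, one_apply_eq_self] at h0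
    have h1 : HasDerivAt (fun x : ℝ => A.appReal x (S f)) (gen ⟨S f, hSf⟩) (-0) := by
      simpa using h0
    have h2 := h1.scomp (0 : ℝ) (hasDerivAt_neg (0 : ℝ))
    simpa [Function.comp_def] using h2
  have hcont : Tendsto (fun x : ℝ => A.appReal (-x) (S (gen ⟨f, hf⟩))) (𝓝 0)
      (𝓝 (A.appReal (-0) (S (gen ⟨f, hf⟩)))) :=
    (((A.continuous_appReal_apply _).comp continuous_neg).tendsto 0)
  have key := hasDerivAt_apply_of_strongDeriv (F := fun x => A.appReal (-x))
    (u := fun x => S (A.appReal x f)) hFu hcont (fun x => A.norm_appReal_le_one (-x)) hu (by simp)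
  simp only [neg_zero, appReal_zero, one_apply_eq_self] at key
  have huniq := (h f).unique key
  rw [huniq]
  abel

end C1

/-! ## §3. The Besov class `𝒞^{1,1}(A; H)` -/

section C11

variable (A : OneParameterUnitaryGroup H)

/-- The second difference `[𝒲(x) - 1]² S = 𝒲(2x)[S] - 2 𝒲(x)[S] + S` of the automorphism group
(ABG (5.2.1): `Σ_{m=0}^{ℓ} (-1)^m (ℓ choose m) S(mx)` with `ℓ = 2`).
[cite: AmreinBoutetdeMonvelGeorgescu1996, §5.2 eq. (5.2.1)] -/
def secondDifference (x : ℝ) (S : H →L[ℂ] H) : H →L[ℂ] H :=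
  A.conjAut (2 * x) S - (2 : ℂ) • A.conjAut x S + S

/-- `[𝒲(x) - 1]² S = 𝒲(x)[𝒲(x)[S] - S] - (𝒲(x)[S] - S)`. [folklore] -/
theorem secondDifference_eq (x : ℝ) (S : H →L[ℂ] H) :
    A.secondDifference x S = A.conjAut x (A.conjAut x S - S) - (A.conjAut x S - S) := by
  rw [secondDifference, conjAut_sub_op, ← conjAut_add, ← two_mul, two_smul]
  abel

/-- The second difference vanishes at `x = 0`. [folklore] -/
@[simp] theorem secondDifference_zero (S : H →L[ℂ] H) : A.secondDifference 0 S = 0 := by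
  simp [secondDifference_eq]

/-- **The regularity class `𝒞^{1,1}(A; H)`** (Besov-type class of order `(s, p) = (1, 1)`):
`S ∈ 𝒞^{1,1}(A; H)` iff `∫_{|x| ≤ 1} ‖ |x|⁻¹ [𝒲(x) - 1]² S ‖ dx/|x| = ∫_{-1}^{1} ‖[𝒲(x) - 1]² S‖ x⁻² dx`
is finite (ABG (5.2.1) with `n = 1`, `s = 1`, `p = 1` and the admissible `ℓ = 2 > s`, i.e. the
characterisation ABG Thm. 5.2.6 (d₂); the choice of `ℓ` is immaterial by ABG Lemma 5.2.1 (a)).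
Written as a lower Lebesgue integral, so no measurability side condition is needed (the integrand
is lower semicontinuous, ABG remark after (5.2.1)). This is the class `C^{1,1}(A)` of Mourre theory
(ABG Thm. 7.4.1); the inclusions `𝒞^{1,1} ⊂ C¹_u ⊂ C¹` (ABG (5.2.19)) are NOT proved here.
[cite: AmreinBoutetdeMonvelGeorgescu1996, §5.2 eq. (5.2.1) and Thm. 5.2.6 (d₂)] -/
def IsOfClassC11 (S : H →L[ℂ] H) : Prop :=
  (∫⁻ x in Set.Icc (-1 : ℝ) 1, ENNReal.ofReal (‖A.secondDifference x S‖ / x ^ 2)) < ∞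

/-- An operator fixed by the automorphism group is of class `𝒞^{1,1}(A; H)` (integrand `0`).
[folklore] -/
theorem isOfClassC11_of_forall_conjAut_eq {S : H →L[ℂ] H} (hS : ∀ x, A.conjAut x S = S) :
    A.IsOfClassC11 S := by
  have h0 : ∀ x, A.secondDifference x S = 0 := fun x => by
    simp [secondDifference_eq, hS]
  simp only [IsOfClassC11, h0, norm_zero, zero_div, ENNReal.ofReal_zero, lintegral_const,
    zero_mul]
  exact ENNReal.zero_lt_top

/-- `1 ∈ 𝒞^{1,1}(A; H)`. [folklore] -/
theorem isOfClassC11_one : A.IsOfClassC11 1 :=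
  A.isOfClassC11_of_forall_conjAut_eq fun x => A.conjAut_one x

end C11

/-! ## §4. Smeared operators, the resolvent, and regularity of an unbounded `H` -/

section Hamiltonian

variable (U : OneParameterUnitaryGroup H)

/-- **The smeared operator** `U[k] = ∫ k(a) U(a) da ∈ B(H)` of an integrable kernel `k` (the tree's
`∫ a, k a • U.appReal a ψ`, bundled as a bounded operator of norm `≤ ‖k‖₁`; junk value `0` for a
non-integrable kernel). [folklore] -/
def smear (k : ℝ → ℂ) : H →L[ℂ] H := by
  classical
  exact if hk : Integrable k then
    LinearMap.mkContinuous
      { toFun := fun f => ∫ a, k a • U.appReal a f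
        map_add' := U.integral_smul_appReal_add hk
        map_smul' := fun c f => U.integral_smul_appReal_smul k c f } (∫ a, ‖k a‖)
      (fun f => U.norm_integral_smul_appReal_le k f)
  else 0

/-- `U[k] f = ∫ k(a) • U(a) f da` for integrable `k`. [folklore] -/
theorem smear_apply {k : ℝ → ℂ} (hk : Integrable k) (f : H) :
    U.smear k f = ∫ a, k a • U.appReal a f := by
  rw [smear, dif_pos hk]
  rfl

/-- The junk value: `U[k] = 0` for non-integrable `k`. [folklore] -/
theorem smear_of_not_integrable {k : ℝ → ℂ} (hk : ¬Integrable k) : U.smear k = 0 := by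
  rw [smear, dif_neg hk]

/-- `‖U[k]‖ ≤ ‖k‖₁`. [folklore] -/
theorem norm_smear_le (k : ℝ → ℂ) : ‖U.smear k‖ ≤ ∫ a, ‖k a‖ := by
  by_cases hk : Integrable k
  · refine ContinuousLinearMap.opNorm_le_bound _ (integral_nonneg fun a => norm_nonneg _) fun f => ?_
    rw [U.smear_apply hk]
    exact U.norm_integral_smul_appReal_le k f
  · rw [U.smear_of_not_integrable hk, norm_zero]
    exact integral_nonneg fun a => norm_nonneg _

/-- The kernel of the resolvent at `z = -i`: `k(t) = -i e^{-t}` for `t ≥ 0`, `0` for `t < 0`, so that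
`∫ k(t) e^{itH} dt = -i ∫₀^∞ e^{-t(1 - iH)} dt = -i (1 - iH)⁻¹ = (H + i)⁻¹`. [folklore] -/
def resolventKernel (t : ℝ) : ℂ :=
  if 0 ≤ t then -I * (Real.exp (-t) : ℂ) else 0

/-- The resolvent kernel is integrable. [folklore] -/
theorem integrable_resolventKernel : Integrable resolventKernel := by
  have h1 : IntegrableOn (fun t : ℝ => -I * (Real.exp (-t) : ℂ)) (Set.Ici 0) := by
    rw [integrableOn_Ici_iff_integrableOn_Ioi]
    have h := (exp_neg_integrableOn_Ioi 0 zero_lt_one).ofReal (𝕜 := ℂ)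
    simp only [neg_mul, one_mul] at h
    exact h.const_mul (-I)
  have h2 : resolventKernel = (Set.Ici (0 : ℝ)).indicator fun t : ℝ => -I * (Real.exp (-t) : ℂ) := by
    funext t
    simp only [resolventKernel, Set.indicator_apply, Set.mem_Ici]
  rw [h2]
  exact h1.integrable_indicator measurableSet_Ici

/-- **The resolvent `(H + i)⁻¹ = -i ∫₀^∞ e^{-t} e^{itH} dt`** of the Hamiltonian of `U(t) = e^{itH}`,
as a bounded operator obtained by smearing the group with `resolventKernel` (Laplace transform of
the group; Hille–Yosida / Reed–Simon I Thm. VIII.7 proof, Engel–Nagel Ch. II Thm. 1.10).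
[cite: ReedSimonI1980, §VIII.3–VIII.4 (proof of Thm VIII.7)] -/
def resolventNegI : H →L[ℂ] H := U.smear resolventKernel

/-- `(H + i)⁻¹ f = ∫ resolventKernel(t) • U(t) f dt`. [folklore] -/
theorem resolventNegI_apply (f : H) : U.resolventNegI f = ∫ t, resolventKernel t • U.appReal t f :=
  U.smear_apply integrable_resolventKernel f

/-- The smooth kernel `t ↦ -i e^{-t}` whose restriction to `t ≥ 0` is `resolventKernel`. [folklore] -/
def negIExp (t : ℝ) : ℂ := -I * (Real.exp (-t) : ℂ)

/-- `resolventKernel = 𝟙_{[0,∞)} · negIExp`. [folklore] -/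
theorem resolventKernel_eq_indicator : resolventKernel = (Set.Ici (0 : ℝ)).indicator negIExp := by
  funext t
  simp only [resolventKernel, negIExp, Set.indicator_apply, Set.mem_Ici]

/-- `d/dt (-i e^{-t}) = i e^{-t} = -negIExp t`. [folklore] -/
theorem hasDerivAt_negIExp (t : ℝ) : HasDerivAt negIExp (-negIExp t) t := by
  have h1 : HasDerivAt (fun s : ℝ => Real.exp (-s)) (Real.exp (-t) * -1) t :=
    (Real.hasDerivAt_exp (-t)).comp t (hasDerivAt_neg t)
  have h2 := (h1.ofReal_comp).const_mul (-I)
  refine h2.congr_deriv ?_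
  simp only [negIExp]
  push_cast
  ring

/-- `negIExp` is continuous. [folklore] -/
theorem continuous_negIExp : Continuous negIExp := by
  unfold negIExp
  fun_prop

/-- `‖-i e^{-t}‖ = e^{-t}`. [folklore] -/
theorem norm_negIExp (t : ℝ) : ‖negIExp t‖ = Real.exp (-t) := by
  rw [negIExp, norm_mul, norm_neg, Complex.norm_I, one_mul, Complex.norm_real, Real.norm_eq_abs,
    abs_of_pos (Real.exp_pos _)]

/-- The resolvent as an integral over `(0, ∞)`: `(H + i)⁻¹ f = ∫₀^∞ (-i e^{-t}) • U(t) f dt`. [folklore] -/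
theorem resolventNegI_apply_eq_setIntegral (f : H) :
    U.resolventNegI f = ∫ t in Set.Ioi 0, negIExp t • U.appReal t f := by
  rw [resolventNegI_apply, ← integral_Ici_eq_integral_Ioi, ← integral_indicator measurableSet_Ici]
  congr 1
  funext t
  rw [resolventKernel_eq_indicator]
  by_cases ht : t ∈ Set.Ici (0 : ℝ) <;> simp [ht]

/-- The smeared orbit with the smooth kernel is integrable on `(0, ∞)`. [folklore] -/
theorem integrableOn_negIExp_smul_appReal (f : H) :
    IntegrableOn (fun t : ℝ => negIExp t • U.appReal t f) (Set.Ioi 0) := by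
  refine ((U.integrable_smul_appReal integrable_resolventKernel f).integrableOn).congr_fun
    (fun t ht => ?_) measurableSet_Ioi
  simp only [resolventKernel_eq_indicator,
    Set.indicator_of_mem (Set.mem_Ici_of_Ioi ht : t ∈ Set.Ici (0 : ℝ))]

/-- **`resolventNegI` inverts `H + i` on the generator side**: for `x ∈ D(H)`,
`(H + i)⁻¹ (iH x) = (H + i)⁻¹ x + i x`, where `iH = OneParameterGroup.generator` is the generator
of `U(t) = e^{itH}` (integration by parts of `∫₀^∞ -i e^{-t} d/dt(U(t)x) dt`; Reed–Simon I,
proof of Thm. VIII.7 / Engel–Nagel Ch. II Thm. 1.10 (Laplace transform of a `C₀`-group is the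
resolvent)). [cite: ReedSimonI1980, Thm VIII.7] -/
theorem resolventNegI_generator
    (x : (OneParameterGroup.generator U.toStrongContRepresentation).domain) :
    U.resolventNegI (OneParameterGroup.generator U.toStrongContRepresentation x) =
      U.resolventNegI x + I • (x : H) := by
  set F : ℝ → H := fun t => negIExp t • U.appReal t (x : H) with hF
  have hderiv : ∀ t, HasDerivAt F
      (negIExp t • U.appReal t (OneParameterGroup.generator U.toStrongContRepresentation x) +
        (-negIExp t) • U.appReal t (x : H)) t := fun t =>
    (hasDerivAt_negIExp t).smul (U.hasDerivAt_appReal_apply x t)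
  have hcont : ContinuousWithinAt F (Set.Ici 0) 0 :=
    (continuous_negIExp.smul (U.continuous_appReal_apply _)).continuousWithinAt
  have hlim : Tendsto F atTop (𝓝 0) := by
    rw [tendsto_zero_iff_norm_tendsto_zero]
    have h : (fun t => ‖F t‖) = fun t => Real.exp (-t) * ‖(x : H)‖ := by
      funext t
      simp only [hF, norm_smul, norm_negIExp, norm_appReal]
    rw [h]
    simpa using Real.tendsto_exp_neg_atTop_nhds_zero.mul_const ‖(x : H)‖
  have hint1 := U.integrableOn_negIExp_smul_appReal
    (OneParameterGroup.generator U.toStrongContRepresentation x)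
  have hint2 : IntegrableOn (fun t : ℝ => (-negIExp t) • U.appReal t (x : H)) (Set.Ioi 0) := by
    refine (U.integrableOn_negIExp_smul_appReal (x : H)).neg.congr_fun (fun t _ => ?_)
      measurableSet_Ioi
    simp only [Pi.neg_apply, neg_smul]
  have hFTC := integral_Ioi_of_hasDerivAt_of_tendsto hcont (fun t _ => hderiv t)
    (hint1.add hint2) hlim
  have hF0 : F 0 = (-I) • (x : H) := by
    simp [hF, negIExp]
  rw [integral_add hint1 hint2, hF0] at hFTC
  have hneg : ∫ t in Set.Ioi 0, (-negIExp t) • U.appReal t (x : H) =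
      -∫ t in Set.Ioi 0, negIExp t • U.appReal t (x : H) := by
    rw [← integral_neg]
    congr 1
    funext t
    rw [neg_smul]
  rw [hneg, zero_sub, neg_smul, neg_neg] at hFTC
  rw [U.resolventNegI_apply_eq_setIntegral, U.resolventNegI_apply_eq_setIntegral, ← hFTC]
  abel

/-- **`(H + i)⁻¹ (H + i) x = x` for `x ∈ D(H)`**, with `H = U.hamiltonian = -i · generator` the
Stone Hamiltonian of `U(t) = e^{itH}`: `resolventNegI` is the resolvent at `z = -i`.
[cite: ReedSimonI1980, Thm VIII.7] -/
theorem resolventNegI_hamiltonian_add (x : U.hamiltonian.domain) :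
    U.resolventNegI (U.hamiltonian x + I • (x : H)) = x := by
  rw [hamiltonian_apply, map_add, map_smul, map_smul, U.resolventNegI_generator x, smul_add,
    smul_smul]
  simp only [neg_mul, Complex.I_mul_I, neg_neg, one_smul, neg_smul]
  abel

/-- **`H` is of class `C¹(A)`** (ABG Def. 6.2.2 with `k = 1`): the self-adjoint generator `H` of
`U(t) = e^{itH}` is of class `C¹(A)` iff its resolvent `(H - z)⁻¹` is of class `C¹(A; H)` for some, and
then (ABG Lemma 6.2.1) every, `z ∉ σ(H)`; we take `z = -i`.
[cite: AmreinBoutetdeMonvelGeorgescu1996, Def. 6.2.2 and Lemma 6.2.1] -/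
def HamiltonianOfClassC1 (A : OneParameterUnitaryGroup H) : Prop :=
  A.IsOfClassC1 U.resolventNegI

/-- **`H` is of class `𝒞^{1,1}(A)`** (ABG Def. 6.2.2 with `(s, p) = (1, 1)`): the resolvent
`(H + i)⁻¹` is of class `𝒞^{1,1}(A; H)` (the regularity hypothesis of the optimal Mourre theorem, ABG
Thm. 7.4.1; strictly between `C²(A)` and `C¹_u(A)`, ABG (5.2.19)). The inclusion in `C¹(A)` is a
theorem (ABG (5.2.19)) not proved here.
[cite: AmreinBoutetdeMonvelGeorgescu1996, Def. 6.2.2] -/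
def HamiltonianOfClassC11 (A : OneParameterUnitaryGroup H) : Prop :=
  A.IsOfClassC11 U.resolventNegI

end Hamiltonian

/-! ## §5. Smooth functions of `H` through the group, and the Mourre estimate -/

section Mourre

variable (U : OneParameterUnitaryGroup H)

/-- **Smooth functional calculus through the group**: for a Schwartz function `g`,
`fourierCalculus U g = ∫ 𝓕g(a) U(a) da = g(H/2π)` — with Mathlib's kernel `e^{-2πi aξ}`,
`∫ 𝓕g(a) e^{iax} da = g(x/2π)` by Fourier inversion, so this is `φ(H)` for `φ = g(·/2π)` (the
dictionary of `FourierSpectrum.lean`; ABG (5.1.2)/(3.2) functional calculus of a `C₀`-group).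
[cite: ReedSimonI1980, Thm VIII.8 and §IX.1] -/
def fourierCalculus (g : 𝓢(ℝ, ℂ)) : H →L[ℂ] H :=
  U.smear fun a => (𝓕 g : 𝓢(ℝ, ℂ)) a

/-- `g(H/2π) f = ∫ 𝓕g(a) • U(a) f da`. [folklore] -/
theorem fourierCalculus_apply (g : 𝓢(ℝ, ℂ)) (f : H) :
    U.fourierCalculus g f = ∫ a, (𝓕 g : 𝓢(ℝ, ℂ)) a • U.appReal a f :=
  U.smear_apply (𝓕 g : 𝓢(ℝ, ℂ)).integrable f

/-- The energy variable in the `2π`-dictionary: `energyWeight ξ = 2πξ`. [folklore] -/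
def energyWeight (ξ : ℝ) : ℂ := ((2 * Real.pi * ξ : ℝ) : ℂ)

/-- `energyWeight` is (the coercion of) a real-linear map, hence of temperate growth. [folklore] -/
theorem energyWeight_hasTemperateGrowth : energyWeight.HasTemperateGrowth := by
  have h : energyWeight = fun ξ : ℝ =>
      (Complex.ofRealCLM.comp ((2 * Real.pi) • ContinuousLinearMap.id ℝ ℝ)) ξ := by
    funext ξ
    simp [energyWeight]
  rw [h]
  exact ContinuousLinearMap.hasTemperateGrowth _

/-- **Multiplication by the energy variable**: `energyMul g = (ξ ↦ 2πξ g(ξ))`, the Schwartz function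
with `(energyMul g)(H/2π) = H g(H/2π)`, i.e. `φ₁(x) = x φ(x)` for `φ = g(·/2π)` (ABG (7.2.18)).
[cite: AmreinBoutetdeMonvelGeorgescu1996, §7.2 eq. (7.2.18)] -/
def energyMul (g : 𝓢(ℝ, ℂ)) : 𝓢(ℝ, ℂ) :=
  SchwartzMap.smulLeftCLM ℂ energyWeight g

/-- `energyMul g ξ = 2πξ · g ξ`. [folklore] -/
@[simp] theorem energyMul_apply (g : 𝓢(ℝ, ℂ)) (ξ : ℝ) :
    energyMul g ξ = ((2 * Real.pi * ξ : ℝ) : ℂ) * g ξ := by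
  rw [energyMul, SchwartzMap.smulLeftCLM_apply_apply energyWeight_hasTemperateGrowth]
  rfl

/-- **The localised first commutator `φ(H) [H, iA] φ(H) ∈ B(H)`** for `φ = g(·/2π)`, defined through
bounded commutators only:
`φ(H)[H, iA]φ(H) = φ(H) [φ₁(H), iA] - φ₁(H) [φ(H), iA]`, `φ₁(x) = x φ(x)`
— the identity ABG (7.2.18) (`= [φ₂(H), iA] - 2 Re {φ₁(H)[φ(H), iA]}… ` rearranged with the
Leibniz rule), which in ABG DEFINES the left side rigorously when `H ∈ C¹(A)`; here it is taken as
the definition (junk `commutatorCLM = 0` off `C¹(A; H)`).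
[cite: AmreinBoutetdeMonvelGeorgescu1996, §7.2 eq. (7.2.18)] -/
def mourreCommutator (A : OneParameterUnitaryGroup H) (g : 𝓢(ℝ, ℂ)) : H →L[ℂ] H :=
  U.fourierCalculus g * A.commutatorCLM (U.fourierCalculus (energyMul g)) -
    U.fourierCalculus (energyMul g) * A.commutatorCLM (U.fourierCalculus g)

/-- **Admissible cutoffs**: `g` is a real Schwartz function of compact support with
`supp g(·/2π) ⊆ J`, i.e. `φ = g(·/2π)` is a real element of `C_c^∞(J)` (the test functions of ABG
(7.2.7)); support in the `2π`-dictionary of `fourierCalculus`. [cite: AmreinBoutetdeMonvelGeorgescu1996, §7.2 eq. (7.2.7)] -/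
def IsRealCutoffOn (J : Set ℝ) (g : 𝓢(ℝ, ℂ)) : Prop :=
  (∀ ξ, conj (g ξ) = g ξ) ∧ HasCompactSupport (g : ℝ → ℂ) ∧
    tsupport (g : ℝ → ℂ) ⊆ (fun ξ : ℝ => 2 * Real.pi * ξ) ⁻¹' J

/-- **Strict Mourre estimate on `J` with constant `a`** (Mourre 1981; ABG (7.2.16) with `K = 0`,
"a strict Mourre estimate holds on `J`", in the smooth form of ABG (7.2.7)): for every real
`φ ∈ C_c^∞(J)` (`φ = g(·/2π)`, `g` an admissible cutoff), `φ(H)` and `φ₁(H) = Hφ(H)` are of class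
`C¹(A; H)` and `a φ(H)² ≤ φ(H)[H, iA]φ(H)` as forms:
`a ‖φ(H)f‖² ≤ Re ⟪f, φ(H)[H, iA]φ(H) f⟫` for all `f`.
Equivalent, for `H ∈ C¹(A)` and bounded open `J`, to `a E(J) ≤ E(J)[H, iA]E(J)`.
[cite: AmreinBoutetdeMonvelGeorgescu1996, §7.2 eqs. (7.2.7), (7.2.16)] -/
def HasMourreEstimateOn (A : OneParameterUnitaryGroup H) (J : Set ℝ) (a : ℝ) : Prop :=
  ∀ g : 𝓢(ℝ, ℂ), IsRealCutoffOn J g →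
    A.IsOfClassC1 (U.fourierCalculus g) ∧ A.IsOfClassC1 (U.fourierCalculus (energyMul g)) ∧
      ∀ f : H, a * ‖U.fourierCalculus g f‖ ^ 2 ≤ (⟪f, U.mourreCommutator A g f⟫_ℂ).re

/-- **Mourre estimate on `J` with constant `a` up to a compact operator** (Mourre 1981 (e);
ABG (7.2.16): `E(J)[H, iA]E(J) ≥ a E(J) + K`, `K` compact, "the Mourre estimate holds on `J`" /
"`A` is conjugate to `H` on `J`"), in the smooth form: there is a compact `K` with
`a φ(H)² + φ(H) K φ(H) ≤ φ(H)[H, iA]φ(H)` for every real `φ ∈ C_c^∞(J)`.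
[cite: AmreinBoutetdeMonvelGeorgescu1996, §7.2 eq. (7.2.16)] -/
def HasMourreEstimateWithCompactOn (A : OneParameterUnitaryGroup H) (J : Set ℝ) (a : ℝ) : Prop :=
  ∃ K : H →L[ℂ] H, IsCompactOperator K ∧
    ∀ g : 𝓢(ℝ, ℂ), IsRealCutoffOn J g →
      A.IsOfClassC1 (U.fourierCalculus g) ∧ A.IsOfClassC1 (U.fourierCalculus (energyMul g)) ∧
        ∀ f : H, a * ‖U.fourierCalculus g f‖ ^ 2 +
            (⟪U.fourierCalculus g f, K (U.fourierCalculus g f)⟫_ℂ).re ≤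
          (⟪f, U.mourreCommutator A g f⟫_ℂ).re

/-- **`A` is strictly conjugate to `H` at `λ`** (ABG §7.2.2: `ϱ_H^A(λ) > 0`): a strict Mourre
estimate with some constant `a > 0` holds on some open interval around `λ`.
[cite: AmreinBoutetdeMonvelGeorgescu1996, §7.2 eq. (7.2.4) and the terminology after Prop. 7.2.5] -/
def IsStrictlyConjugateAt (A : OneParameterUnitaryGroup H) (lam : ℝ) : Prop :=
  ∃ a : ℝ, 0 < a ∧ ∃ δ : ℝ, 0 < δ ∧ U.HasMourreEstimateOn A (Set.Ioo (lam - δ) (lam + δ)) a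

/-- **`A` is conjugate to `H` at `λ`** (ABG §7.2.2: `ϱ̃_H^A(λ) > 0`, i.e. (7.2.16) on an open interval
`J ∋ λ` with `a > 0` and a compact `K`; Mourre 1981 condition (e)).
[cite: AmreinBoutetdeMonvelGeorgescu1996, §7.2 eq. (7.2.16)] -/
def IsConjugateAt (A : OneParameterUnitaryGroup H) (lam : ℝ) : Prop :=
  ∃ a : ℝ, 0 < a ∧ ∃ δ : ℝ, 0 < δ ∧
    U.HasMourreEstimateWithCompactOn A (Set.Ioo (lam - δ) (lam + δ)) a

variable {U}

/-- Admissible cutoffs on a smaller set are admissible on a larger one. [folklore] -/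
theorem IsRealCutoffOn.mono {J J' : Set ℝ} {g : 𝓢(ℝ, ℂ)} (h : IsRealCutoffOn J' g) (hJ : J' ⊆ J) :
    IsRealCutoffOn J g :=
  ⟨h.1, h.2.1, h.2.2.trans (Set.preimage_mono hJ)⟩

/-- A Mourre estimate restricts to subsets (ABG proof of Prop. 7.2.3 (a): pre/post-multiplication
by `E(λ; ε)`). [cite: AmreinBoutetdeMonvelGeorgescu1996, Prop. 7.2.3 (a)] -/
theorem HasMourreEstimateOn.mono {A : OneParameterUnitaryGroup H} {J J' : Set ℝ} {a : ℝ}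
    (h : U.HasMourreEstimateOn A J a) (hJ : J' ⊆ J) : U.HasMourreEstimateOn A J' a :=
  fun g hg => h g (hg.mono hJ)

/-- A Mourre estimate with constant `a` implies one with any smaller constant. [folklore] -/
theorem HasMourreEstimateOn.of_le {A : OneParameterUnitaryGroup H} {J : Set ℝ} {a a' : ℝ}
    (h : U.HasMourreEstimateOn A J a) (ha : a' ≤ a) : U.HasMourreEstimateOn A J a' := by
  intro g hg
  obtain ⟨h1, h2, h3⟩ := h g hg
  refine ⟨h1, h2, fun f => le_trans ?_ (h3 f)⟩
  exact mul_le_mul_of_nonneg_right ha (sq_nonneg _)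

/-- A strict Mourre estimate is a Mourre estimate with compact remainder `K = 0`. [folklore] -/
theorem HasMourreEstimateOn.withCompact {A : OneParameterUnitaryGroup H} {J : Set ℝ} {a : ℝ}
    (h : U.HasMourreEstimateOn A J a) : U.HasMourreEstimateWithCompactOn A J a := by
  refine ⟨0, isCompactOperator_zero, fun g hg => ?_⟩
  obtain ⟨h1, h2, h3⟩ := h g hg
  refine ⟨h1, h2, fun f => ?_⟩
  simpa using h3 f

/-- The compact-remainder estimate restricts to subsets. [cite: AmreinBoutetdeMonvelGeorgescu1996, Prop. 7.2.6] -/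
theorem HasMourreEstimateWithCompactOn.mono {A : OneParameterUnitaryGroup H} {J J' : Set ℝ} {a : ℝ}
    (h : U.HasMourreEstimateWithCompactOn A J a) (hJ : J' ⊆ J) :
    U.HasMourreEstimateWithCompactOn A J' a := by
  obtain ⟨K, hK, h⟩ := h
  exact ⟨K, hK, fun g hg => h g (hg.mono hJ)⟩

/-- Strictly conjugate implies conjugate (`ϱ̃ ≥ ϱ`, ABG Prop. 7.2.6).
[cite: AmreinBoutetdeMonvelGeorgescu1996, Prop. 7.2.6] -/
theorem IsStrictlyConjugateAt.isConjugateAt {A : OneParameterUnitaryGroup H} {lam : ℝ}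
    (h : U.IsStrictlyConjugateAt A lam) : U.IsConjugateAt A lam := by
  obtain ⟨a, ha, δ, hδ, h⟩ := h
  exact ⟨a, ha, δ, hδ, h.withCompact⟩

/-- Shrinking the window: a strict Mourre estimate around `λ` on `(λ - δ, λ + δ)` gives one on every
smaller symmetric window. [folklore] -/
theorem HasMourreEstimateOn.of_Ioo_subset {A : OneParameterUnitaryGroup H} {lam δ δ' a : ℝ}
    (h : U.HasMourreEstimateOn A (Set.Ioo (lam - δ) (lam + δ)) a) (hδ : δ' ≤ δ) :
    U.HasMourreEstimateOn A (Set.Ioo (lam - δ') (lam + δ')) a :=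
  h.mono (Set.Ioo_subset_Ioo (by linarith) (by linarith))

end Mourre

end UnitaryRep

end Literature.Analysis.UnboundedOperators
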